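import Summits.Ventures.DiscreteObjects.PP12.FanoFiveECodeWords

/-!
# PP(12), order 5: a kernel-evaluable CHECKER for word codes and its SOUNDNESS (kernel; the certificate format for the order-5 cell)
Framing: lottery ticket; floor = certified bounds/negative ranges.

Cell pub-namedobj (venture DiscreteObjects), target (M), designs gen 17 (HANDOFF item (c), first half). `FanoFiveECodeWords` reduced the order-5 cell to
`NoWordCode` (no 16-set of 7-bit words `∋ 0, 95, 63` with balance, Hamming profile `(4,9,2)` and bit-pair condition). Here: a depth-first refutation procedure
`Cert.noCompl` over increasing lists of weight-4 words (the weight-2 words `A` being fixed), with the prunings of designs g17's engine `ecode2.c` (distance-class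
caps `4 / 9 / 2` kept as a per-node table `ents`, column cap `8`, column feasibility), written so that `decide +kernel` can evaluate it (measured on the farm, designs g17: a 239-node subtree in ≈ 25 s within DEFAULT heartbeats;
a 658-node subtree exceeds them — budget ≈ 300–500 DFS nodes per theorem with this proof-friendly version, ≈ 0.1 s per node; the incremental
prototype code/cert/Proto2.lean is ≈ 2.5× faster), and the soundness of its PRUNINGS (`not_fullP_of_okAdd_false`, `_colOk_false`, `_feas_false`) plus assembly lemmas for split certificates;
the soundness of the SEARCH and **`Cert.noWordCode_of_checked : (∀ A, A <+ W2 → A.length = 4 → noCompl 9 ([0, 95, 63] ++ A) W4 = true) → NoWordCode`**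
follow in `FanoFiveWordCheckerSound`.
So the order-5 cell of PP(12) becomes a kernel theorem as soon as the hypothesis is discharged — per quadruple `A` by `decide +kernel` on subtrees of
≤ ≈ 400 nodes (assembled by unfolding `scan`), over all `5985` quadruples or, with `FanoFiveECodeWordsPerm.IsWordCode.perm` and a decidable covering table,
over the `34 + (inadmissible)` orbit representatives: ≈ 8·10⁵ DFS nodes in total (results/ecode_orbits.txt), i.e. ≈ 2000–2700 small theorems / ≈ 20 h of
farm elaboration — a successor campaign of the size of the mahler cell's degree-22 census. Nothing is discharged here; nothing asserts any census statement.
No `sorry`, no new axioms.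
-/

namespace Summit.Ventures.DiscreteObjects.PP12

open Finset

namespace FanoFive

namespace Cert

/-- number of set bits among the seven low bits (arithmetic, kernel-fast) -/
def popc7 (n : ℕ) : ℕ :=
  (n &&& 1) + ((n >>> 1) &&& 1) + ((n >>> 2) &&& 1) + ((n >>> 3) &&& 1) + ((n >>> 4) &&& 1) + ((n >>> 5) &&& 1) + ((n >>> 6) &&& 1)

/-- Hamming distance on the seven low bits (kernel-evaluable: popcount of the `xor`) -/
def hd (v w : ℕ) : ℕ := popc7 (v ^^^ w)

/-- number of words of `ws` at distance `d` from `u` -/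
def cntd (ws : List ℕ) (u d : ℕ) : ℕ := ws.countP fun w => hd u w == d

/-- number of words of `ws` with bit `x` set -/
def colc (ws : List ℕ) (x : Fin 7) : ℕ := ws.countP fun w => w.testBit x

/-- number of words of `ws` whose bits `x` and `y` differ -/
def colpair (ws : List ℕ) (x y : Fin 7) : ℕ := ws.countP fun w => w.testBit x != w.testBit y

/-- the `21` words of weight `2` and the `35` words of weight `4` (ascending) -/
def W2 : List ℕ := [3, 5, 6, 9, 10, 12, 17, 18, 20, 24, 33, 34, 36, 40, 48, 65, 66, 68, 72, 80, 96]
/-- the `35` words of weight `4` (ascending) -/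
def W4 : List ℕ := [15, 23, 27, 29, 30, 39, 43, 45, 46, 51, 53, 54, 57, 58, 60, 71, 75, 77, 78, 83, 85, 86, 89, 90, 92, 99, 101, 102, 105, 106, 108,
  113, 114, 116, 120]

/-- per-node table: every current word with its three distance-class counts (computed once per node) -/
def ents (ws : List ℕ) : List (ℕ × ℕ × ℕ × ℕ) := ws.map fun u => (u, cntd ws u 2, cntd ws u 4, cntd ws u 6)

/-- no column exceeds `8` -/
def colOk (ws : List ℕ) : Bool := (List.finRange 7).all fun x => colc ws x ≤ 8

/-- adding `c` does not overflow a column -/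
def colOkAdd (ws : List ℕ) (c : ℕ) : Bool := (List.finRange 7).all fun x => !(c.testBit x) || colc ws x + 1 ≤ 8

/-- may `c` be added? no current word's cap is exceeded by `c`, `c` itself respects the caps, no column overflows -/
def okAdd (es : List (ℕ × ℕ × ℕ × ℕ)) (ws : List ℕ) (c : ℕ) : Bool :=
  es.all (fun e => (!(hd e.1 c == 2) || e.2.1 + 1 ≤ 4) && (!(hd e.1 c == 4) || e.2.2.1 + 1 ≤ 9) && (!(hd e.1 c == 6) || e.2.2.2 + 1 ≤ 2)) &&
  (cntd ws c 2 ≤ 4 && cntd ws c 4 ≤ 9 && cntd ws c 6 ≤ 2) && colOkAdd ws c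

/-- column feasibility with `rem` weight-4 words still to be added -/
def feas (ws : List ℕ) (rem : ℕ) : Bool :=
  colOk ws && (List.finRange 7).all (fun x => 8 ≤ colc ws x + rem) && (((List.finRange 7).map fun x => 8 - colc ws x).sum == 4 * rem)

/-- the leaf test, as a proposition: balance, exact profile, bit-pair counts -/
def FullP (ws : List ℕ) : Prop :=
  (∀ x : Fin 7, colc ws x = 8) ∧ (∀ u ∈ ws, cntd ws u 2 = 4 ∧ cntd ws u 4 = 9 ∧ cntd ws u 6 = 2) ∧
  (∀ x y : Fin 7, x ≠ y → colpair ws x y = 6 ∨ colpair ws x y = 8 ∨ colpair ws x y = 10)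

/-- the leaf test is decidable (evaluated by the kernel at the leaves) -/
instance (ws : List ℕ) : Decidable (FullP ws) := by unfold FullP; exact inferInstance

/-- scan the candidates: each admissible one must be refuted by the continuation on the remaining suffix -/
def scan (f : List ℕ → List ℕ → Bool) (es : List (ℕ × ℕ × ℕ × ℕ)) (ws : List ℕ) : List ℕ → Bool
  | [] => true
  | c :: cs => (!(okAdd es ws c) || f (ws ++ [c]) cs) && scan f es ws cs

/-- **the checker**: `noCompl k ws cands = true` refutes every completion of `ws` by `k` words taken increasingly from `cands` -/
def noCompl : ℕ → List ℕ → List ℕ → Bool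
  | 0, ws, _ => !decide (FullP ws)
  | k + 1, ws, cands => !(feas ws (k + 1)) || scan (noCompl k) (ents ws) ws cands

/-! ### assembling a refutation from refutations of subtrees (for certificates split across several `decide` theorems) -/

/-- the empty candidate list is trivially scanned -/
theorem scan_nil (f : List ℕ → List ℕ → Bool) (es : List (ℕ × ℕ × ℕ × ℕ)) (ws : List ℕ) : scan f es ws [] = true := rfl

/-- a rejected first candidate: the scan reduces to the tail (the guard `okAdd … = false` is cheap to `decide`) -/
theorem scan_cons_of_rejected {f : List ℕ → List ℕ → Bool} {es : List (ℕ × ℕ × ℕ × ℕ)} {ws : List ℕ} {c : ℕ} {cs : List ℕ}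
    (h : okAdd es ws c = false) (h2 : scan f es ws cs = true) : scan f es ws (c :: cs) = true := by
  simp [scan, h, h2]

/-- an admissible first candidate refuted separately (a child theorem `f (ws ++ [c]) cs = true`) -/
theorem scan_cons_of_child {f : List ℕ → List ℕ → Bool} {es : List (ℕ × ℕ × ℕ × ℕ)} {ws : List ℕ} {c : ℕ} {cs : List ℕ}
    (h : f (ws ++ [c]) cs = true) (h2 : scan f es ws cs = true) : scan f es ws (c :: cs) = true := by
  simp [scan, h, h2]

/-- scan of a SEGMENT `l₁` of the candidate list, the continuation seeing the rest `l₂` (lets a certificate pack several sibling subtrees into one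
`decide`, cutting the candidate list at arbitrary positions) -/
def scanSeg (f : List ℕ → List ℕ → Bool) (es : List (ℕ × ℕ × ℕ × ℕ)) (ws : List ℕ) : List ℕ → List ℕ → Bool
  | [], _ => true
  | c :: cs, l₂ => (!(okAdd es ws c) || f (ws ++ [c]) (cs ++ l₂)) && scanSeg f es ws cs l₂

/-- cutting a scan: segment, then the rest -/
theorem scan_append (f : List ℕ → List ℕ → Bool) (es : List (ℕ × ℕ × ℕ × ℕ)) (ws : List ℕ) :
    ∀ l₁ l₂ : List ℕ, scan f es ws (l₁ ++ l₂) = (scanSeg f es ws l₁ l₂ && scan f es ws l₂)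
  | [], l₂ => by simp [scanSeg]
  | c :: cs, l₂ => by
    simp only [List.cons_append, scan, scanSeg, scan_append f es ws cs l₂, Bool.and_assoc]

/-- assembling a scan from a `decide`d segment and the (separately proved) rest -/
theorem scan_of_seg {f : List ℕ → List ℕ → Bool} {es : List (ℕ × ℕ × ℕ × ℕ)} {ws : List ℕ} {l₁ l₂ : List ℕ}
    (h₁ : scanSeg f es ws l₁ l₂ = true) (h₂ : scan f es ws l₂ = true) : scan f es ws (l₁ ++ l₂) = true := by
  rw [scan_append, h₁, h₂]; rfl

/-- a node from the scan of its children -/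
theorem noCompl_succ_of_scan {k : ℕ} {ws cands : List ℕ} (h : scan (noCompl k) (ents ws) ws cands = true) : noCompl (k + 1) ws cands = true := by
  simp [noCompl, h]

/-! ### soundness of the prunings -/

/-- `countP` is monotone along sublists (restated for convenience) -/
theorem countP_le_of_sublist {l₁ l₂ : List ℕ} (h : l₁.Sublist l₂) (p : ℕ → Bool) : l₁.countP p ≤ l₂.countP p := h.countP_le

/-- an overfull column stays overfull in every extension -/
theorem not_fullP_of_colOk_false {ws L : List ℕ} (hsub : ws.Sublist L) (h : colOk ws = false) : ¬ FullP L := by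
  intro hF
  unfold colOk at h
  rw [List.all_eq_false] at h
  obtain ⟨x, -, hbad⟩ := h
  have m := countP_le_of_sublist hsub (fun w => w.testBit x)
  have e := hF.1 x
  unfold colc at e hbad
  simp only [decide_eq_true_eq, not_le] at hbad
  omega

/-- counts after appending one word -/
theorem cntd_append_singleton (ws : List ℕ) (u c d : ℕ) : cntd (ws ++ [c]) u d = cntd ws u d + (if hd u c = d then 1 else 0) := by
  unfold cntd
  rw [List.countP_append]
  simp

/-- a column overflow caused by `c` refutes every extension -/
theorem not_fullP_of_colOkAdd_false {ws L : List ℕ} {c : ℕ} (hsub : (ws ++ [c]).Sublist L) (h : colOkAdd ws c = false) : ¬ FullP L := by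
  intro hF
  unfold colOkAdd at h
  rw [List.all_eq_false] at h
  obtain ⟨x, -, hbad⟩ := h
  have m := countP_le_of_sublist hsub (fun w => w.testBit x)
  have e := hF.1 x
  have a : colc (ws ++ [c]) x = colc ws x + (if c.testBit x = true then 1 else 0) := by
    unfold colc; rw [List.countP_append]; simp
  simp only [Bool.or_eq_true, Bool.not_eq_true', decide_eq_true_eq, not_or, not_le, Bool.not_eq_false] at hbad
  rw [if_pos hbad.1] at a
  have hb := hbad.2
  unfold colc at e a m hb
  omega

/-- **a rejected candidate refutes every extension**: some cap or column is already exceeded in `ws ++ [c]` -/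
theorem not_fullP_of_okAdd_false {ws L : List ℕ} {c : ℕ} (hsub : (ws ++ [c]).Sublist L) (h : okAdd (ents ws) ws c = false) : ¬ FullP L := by
  intro hF
  have hws : ws.Sublist L := (List.sublist_append_left ws [c]).trans hsub
  have hcL : c ∈ L := hsub.subset (by simp)
  unfold okAdd at h
  simp only [Bool.and_eq_false_iff] at h
  rcases h with (h | h) | h
  · -- a current word `u` would exceed a cap
    rw [List.all_eq_false] at h
    obtain ⟨e, he, hbad⟩ := h
    unfold ents at he
    rw [List.mem_map] at he
    obtain ⟨u, hu, rfl⟩ := he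
    have huL : u ∈ L := hws.subset hu
    obtain ⟨h2, h4, h6⟩ := hF.2.1 u huL
    have m2 := countP_le_of_sublist hsub (fun w => hd u w == 2)
    have m4 := countP_le_of_sublist hsub (fun w => hd u w == 4)
    have m6 := countP_le_of_sublist hsub (fun w => hd u w == 6)
    have a2 := cntd_append_singleton ws u c 2
    have a4 := cntd_append_singleton ws u c 4
    have a6 := cntd_append_singleton ws u c 6
    simp only [Bool.and_eq_true, Bool.or_eq_true, Bool.not_eq_true', beq_eq_false_iff_ne, ne_eq, decide_eq_true_eq,
      not_and, not_or, not_le] at hbad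
    unfold cntd at h2 h4 h6 a2 a4 a6 hbad
    split_ifs at a2 a4 a6 <;> omega
  · -- `c` itself would exceed a cap
    obtain ⟨h2, h4, h6⟩ := hF.2.1 c hcL
    have m2 := countP_le_of_sublist hws (fun w => hd c w == 2)
    have m4 := countP_le_of_sublist hws (fun w => hd c w == 4)
    have m6 := countP_le_of_sublist hws (fun w => hd c w == 6)
    unfold cntd at h2 h4 h6 h
    simp only [not_le, decide_eq_false_iff_not] at h
    omega
  · exact not_fullP_of_colOkAdd_false hsub h hF

/-- every word of `W4` has exactly four of the seven low bits set -/
theorem colc_W4 : ∀ c ∈ W4, ((List.finRange 7).map fun x : Fin 7 => if c.testBit x then 1 else 0).sum = 4 := by decide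

/-- column counts of an appended list -/
theorem colc_append (ws C : List ℕ) (x : Fin 7) : colc (ws ++ C) x = colc ws x + colc C x := by
  unfold colc; rw [List.countP_append]

/-- a column count is at most the length -/
theorem colc_le_length (C : List ℕ) (x : Fin 7) : colc C x ≤ C.length := List.countP_le_length

/-- the total number of set bits of a list of weight-4 words is four times its length -/
theorem sum_colc_of_W4 {C : List ℕ} (hC : ∀ c ∈ C, c ∈ W4) : ((List.finRange 7).map fun x : Fin 7 => colc C x).sum = 4 * C.length := by
  induction C with
  | nil => simp [colc]
  | cons c C ih =>
    have hc : c ∈ W4 := hC c (by simp)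
    have hC' : ∀ c' ∈ C, c' ∈ W4 := fun c' h' => hC c' (by simp [h'])
    have e : ((List.finRange 7).map fun x : Fin 7 => colc (c :: C) x) =
        (List.finRange 7).map fun x : Fin 7 => (if c.testBit x then 1 else 0) + colc C x := by
      refine List.map_congr_left fun x _ => ?_
      unfold colc
      rw [List.countP_cons]
      split_ifs <;> omega
    rw [e, List.sum_map_add, colc_W4 c hc, ih hC']
    simp only [List.length_cons]
    omega

/-- infeasible columns refute every completion by weight-4 words -/
theorem not_fullP_of_feas_false {ws C : List ℕ} (hC : ∀ c ∈ C, c ∈ W4) (h : feas ws C.length = false) : ¬ FullP (ws ++ C) := by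
  intro hF
  have hcol : ∀ x : Fin 7, colc ws x + colc C x = 8 := fun x => by rw [← colc_append]; exact hF.1 x
  unfold feas at h
  simp only [Bool.and_eq_false_iff] at h
  rcases h with (h | h) | h
  · exact not_fullP_of_colOk_false (List.sublist_append_left ws C) h hF
  · rw [List.all_eq_false] at h
    obtain ⟨x, -, hx⟩ := h
    simp only [decide_eq_true_eq, not_le] at hx
    have := hcol x
    have := colc_le_length C x
    omega
  · simp only [beq_eq_false_iff_ne, ne_eq] at h
    apply h
    have e : ((List.finRange 7).map fun x : Fin 7 => 8 - colc ws x) = (List.finRange 7).map fun x : Fin 7 => colc C x :=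
      List.map_congr_left fun x _ => by have := hcol x; omega
    rw [e, sum_colc_of_W4 hC]

end Cert

end FanoFive

end Summit.Ventures.DiscreteObjects.PP12
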